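import Summits.QuantumAdvantage.QuantumAdvantage.Theorems.LinnikCubicClassGroupsDegreeOnePrimesEscapeCubicInertPrime
import Summits.QuantumAdvantage.QuantumAdvantage.Theorems.LinnikCubicClassGroupsDegreeOnePrimesEscapeCubicSplitPrime
import HarnessLib

/-!
# Chebotarev–Linnik for `S₃`-cubic fields: a prime of each splitting type below `|d_K|^L`

Topic `Summits/QuantumAdvantage/QuantumAdvantage/Theorems`, cell B2b-1 (linnik-cubic), PART A (gen 7);
helper toward the crux `DegreeOnePrimesEscape` (stmt-QuantumAdvantage-11543) of route
`LinnikCubicClassGroups`.  HONEST FRAMING: the value of this file is a THEOREM (kernel-checked, GRH-free,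
Siegel-free, no hypothesis) — NOT summit progress.

`exists_prime_of_each_splittingType_le` assembles the three conjugacy classes of `Gal(N/ℚ) ≅ S₃` for a
non-Galois cubic field `K` (identity: `T_K(p) = {1,1,1}`, `exists_splitPrime_le`; transpositions:
`T_K(p) = {1,2}`, `exists_partialPrime_le`; 3-cycles: `p𝓞_K` prime, `exists_inertPrime_le_of_not_isGalois`)
into one statement with one absolute exponent: the least prime in EVERY Frobenius class of an `S₃`-cubic
field is `≤ |d_K|^{L}` (Lagarias–Montgomery–Odlyzko 1979 for `S₃`; explicit exponents are known in print —
Cho–Kim, Cho–Lemke Oliver–Zaman arXiv:2512.24963 — and are out of reach of the tree's existential constants;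
this is an independent kernel-checked certification by the log-free density / Deuring–Heilbronn route).
-/

noncomputable section

open scoped NumberField nonZeroDivisors
open Ideal NumberField
open Literature.NumberTheory.NumberFields

namespace Summit.QuantumAdvantage.QuantumAdvantage.Theorems.DegreeOnePrimesEscape

/-- **Chebotarev–Linnik for `S₃`-cubic fields**: there is an absolute `L > 0` such that every cubic number
field `K` that is not Galois over `ℚ` has, below `|d_K|^{L}`, a prime of each of the three splitting types:
a completely split prime (`T_K(p) = {1,1,1}`), a prime of type `(1,2)`, and an inert prime (`p𝓞_K` prime).
[cite: LagariasMontgomeryOdlyzko1979, Theorem 1.1] -/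
theorem exists_prime_of_each_splittingType_le :
    ∃ L : ℝ, 0 < L ∧ ∀ (K : Type) [Field K] [NumberField K], Module.finrank ℚ K = 3 → ¬ IsGalois ℚ K →
      (∃ p : ℕ, p.Prime ∧ (p : ℝ) ≤ ((NumberField.discr K).natAbs : ℝ) ^ L ∧
          ¬ ((p : ℤ) ∣ NumberField.discr K) ∧ splittingType K p = {1, 1, 1}) ∧
      (∃ p : ℕ, p.Prime ∧ (p : ℝ) ≤ ((NumberField.discr K).natAbs : ℝ) ^ L ∧
          ¬ ((p : ℤ) ∣ NumberField.discr K) ∧ splittingType K p = {1, 2}) ∧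
      (∃ p : ℕ, p.Prime ∧ (p : ℝ) ≤ ((NumberField.discr K).natAbs : ℝ) ^ L ∧
          (Ideal.span {(p : 𝓞 K)}).IsPrime) := by
  obtain ⟨L₁, hL₁, h₁⟩ := exists_splitPrime_le
  obtain ⟨L₂, hL₂, h₂⟩ := exists_partialPrime_le
  obtain ⟨L₃, hL₃, h₃⟩ := exists_inertPrime_le_of_not_isGalois
  refine ⟨max L₁ (max L₂ L₃), lt_max_of_lt_left hL₁, fun K _ _ h3 hKng ↦ ?_⟩
  have hd1 : (1 : ℝ) ≤ ((NumberField.discr K).natAbs : ℝ) := by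
    have h1 := Int.one_le_abs (NumberField.discr_ne_zero K)
    rw [Int.abs_eq_natAbs] at h1; exact_mod_cast h1
  have hmono : ∀ {s : ℝ}, s ≤ max L₁ (max L₂ L₃) →
      ((NumberField.discr K).natAbs : ℝ) ^ s ≤ ((NumberField.discr K).natAbs : ℝ) ^ max L₁ (max L₂ L₃) :=
    fun hs ↦ Real.rpow_le_rpow_of_exponent_le hd1 hs
  refine ⟨?_, ?_, ?_⟩
  · obtain ⟨p, hp, hpx, hd, hT⟩ := h₁ K h3 hKng
    exact ⟨p, hp, hpx.trans (hmono (le_max_left _ _)), hd, hT⟩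
  · obtain ⟨p, hp, hpx, hd, hT⟩ := h₂ K h3 hKng
    exact ⟨p, hp, hpx.trans (hmono (le_trans (le_max_left _ _) (le_max_right _ _))), hd, hT⟩
  · obtain ⟨p, hp, hpx, hP⟩ := h₃ K h3 hKng
    exact ⟨p, hp, hpx.trans (hmono (le_trans (le_max_right _ _) (le_max_right _ _))), hP⟩

end Summit.QuantumAdvantage.QuantumAdvantage.Theorems.DegreeOnePrimesEscape

end
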